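import Mathlib
import HarnessLib
import Summits.QuantumFields.YangMills.Theses.PencilRigidity
import Summits.QuantumFields.YangMills.Theorems.PencilRigidityCurvatureKernelBoundLatticeWindowTransfer
import Summits.QuantumFields.YangMills.Theorems.PencilRigidityCurvatureKernelBoundAxisEnvelopeSymmetry

/-!
# `CurvatureKernelBound` — stub I₂ `AxialGrowthOfLocalDecay` (support for stmt-QuantumFields-11687)

Support file for crux `stmt-QuantumFields-11687` (`PencilRigidity.CurvatureKernelBound`), line
`sixteen-charts-analytic-kernel`, stub I₂ `AxialGrowthOfLocalDecay` (skeleton v15): one half of the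
sufficiency direction of the continuum characterisation `CurvatureKernelBound ↔ TwoPointLocalDecay`.

**Statement.** Assume T `TwoPointLocalDecay`: for every `W₁`-datum `(r, sch, S₁)` there are `C, η > 0, s₁ > 0`
such that for `0 < s < s₁` the two-point function obeys, on real tensors `F = f 0 ⊗ f 1` with `f 0`, `f 1`
supported in the closed `r`-balls (`r ≤ r₀(s)`) about `−s e₀`, `+s e₀` and `|f i| ≤ M_i`,
`‖S₁ 2 F‖ ≤ A ‖f 0‖₁ ‖f 1‖₁ + B r⁸ M₀ M₁` with `A + B ≤ C s^(η−10)`. Then for every `W₁`-datum every kernel `K`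
continuous off `0` and representing `S₁ 2` on `⁰𝒮₂` satisfies the axial growth bound
`‖K(s e₀)‖ ≤ C' s^(η'−10)` on `(0, 1]` (`η' = min η 10`).

**Route** (the continuum half of `LatticeWindowTransfer`, with the lattice side replaced by one application
of T). Fix `0 < s ≤ s₀ = min 1 s₁` and apply T at height `s/2`, obtaining `r₀, A, B`. Put
`c₀ = −(s/2) e₀`, `c₁ = (s/2) e₀`, `ξ = c₀ − c₁ = −s e₀ ≠ 0`, a continuity radius `ρ` of `K` at `ξ`
(oscillation `< 1`) and `ε = min(ρ/4, r₀, s/8)`; let `g`, `h` be standard bumps of radii `(ε/2, ε)` at `c₀`,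
`c₁` (their supports are disjoint closed `ε`-balls, so `g ⊗ h ∈ ⁰𝒮₂` is a real tensor to which T applies with
`M₀ = M₁ = 1`): `‖S₁ 2 (g ⊗ h)‖ ≤ A (∫g)(∫h) + B ε⁸`. Bump localisation at the two centres gives
`‖S₁ 2 (g ⊗ h) − K(ξ)(∫g)(∫h)‖ ≤ (∫g)(∫h)`, and `∫g, ∫h ≥ (ε/2)⁴ v₁` (`v₁ = vol B̄(0,1)`), whence
`‖K(ξ)‖ ≤ 1 + A + 2⁸ B / v₁² ≤ 1 + (1 + 2⁸/v₁²) max(C,0) (s/2)^(η−10)`. Evenness of representing kernels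
(`kernel_neg`: `−1` is a proper signed permutation of `ℝ⁴`) moves the bound from `−s e₀` to `s e₀`. On `[s₀, 1]`
continuity of `K` on the compact axial segment bounds it, and `1 ≤ s^(η'−10)`, `s^(η−10) ≤ s^(η'−10)` on
`(0, 1]` assemble the constant. [folklore]
-/

noncomputable section

open scoped BigOperators Topology SchwartzMap ComplexConjugate
open MeasureTheory Filter Set
open Literature.MathematicalPhysics.QuantumLattice Literature.MathematicalPhysics.AQFT
open Literature.MathematicalPhysics.QuantumFieldTheory

namespace Summit.QuantumFields.YangMills.Theorems.CurvatureKernel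

namespace AxialGrowthOfLocalDecayAux

/-- **Bump localisation at two centres.** Let `g`, `h` be standard bumps centred at `c₀`, `c₁` with
`r_out(g) + r_out(h) ≤ ρ`, `ρ` a continuity radius of `K` at `c₀ − c₁` with oscillation `< 1`, and
`F = g ⊗ h` pointwise. Then `‖∫ K(x₀−x₁) F(x) dx − K(c₀ − c₁) (∫g)(∫h)‖ ≤ (∫g)(∫h)` (on the support of
`F ≥ 0` the point `x₀ − x₁` is `ρ`-close to `c₀ − c₁`; Fubini). [folklore] -/
theorem norm_integral_kernel_two_bumps_sub_le {K : EuclideanSpace ℝ (Fin 4) → ℂ}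
    {c₀ c₁ : EuclideanSpace ℝ (Fin 4)} {ρ : ℝ}
    (hρK : ∀ z : EuclideanSpace ℝ (Fin 4), dist z (c₀ - c₁) < ρ → dist (K z) (K (c₀ - c₁)) < 1)
    (g : ContDiffBump c₀) (h : ContDiffBump c₁)
    (hgh : g.rOut + h.rOut ≤ ρ) {F : (Fin 2 → EuclideanSpace ℝ (Fin 4)) → ℂ}
    (F_apply : ∀ x : Fin 2 → EuclideanSpace ℝ (Fin 4), F x = ((g (x 0) * h (x 1) : ℝ) : ℂ))
    (hFi : Integrable F)
    (hint : Integrable (fun x : Fin 2 → EuclideanSpace ℝ (Fin 4) => K (x 0 - x 1) * F x)) :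
    ‖(∫ x : Fin 2 → EuclideanSpace ℝ (Fin 4), K (x 0 - x 1) * F x) -
      K (c₀ - c₁) * (((∫ y, g y) * ∫ y, h y : ℝ) : ℂ)‖ ≤ (∫ y, g y) * ∫ y, h y := by
  -- adapted from `BoundedRenormalisation.norm_integral_kernel_bumps_sub_le` (second bump centred at `c₁`)
  -- the real tensor `g ⊗ h`: integrable, with integral `(∫g)(∫h)` (Fubini)
  have hintgh : Integrable (fun x : Fin 2 → EuclideanSpace ℝ (Fin 4) => g (x 0) * h (x 1)) := by
    refine hFi.norm.congr (Eventually.of_forall fun x => ?_)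
    show ‖F x‖ = g (x 0) * h (x 1)
    rw [F_apply, Complex.norm_real, Real.norm_of_nonneg (mul_nonneg g.nonneg h.nonneg)]
  have hIgh : ∫ x : Fin 2 → EuclideanSpace ℝ (Fin 4), g (x 0) * h (x 1) = (∫ y, g y) * ∫ y, h y := by
    simpa [Fin.prod_univ_two] using integral_fintype_prod_volume_eq_prod (𝕜 := ℝ)
      (E := fun _ : Fin 2 => EuclideanSpace ℝ (Fin 4)) ![(g : EuclideanSpace ℝ (Fin 4) → ℝ), h]
  have hIF : ∫ x : Fin 2 → EuclideanSpace ℝ (Fin 4), F x = (((∫ y, g y) * ∫ y, h y : ℝ) : ℂ) := by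
    rw [integral_congr_ae (Eventually.of_forall F_apply), integral_complex_ofReal, hIgh]
  -- pointwise bound on the support of `g ⊗ h`
  have hK1 : ∀ x : Fin 2 → EuclideanSpace ℝ (Fin 4),
      ‖(K (x 0 - x 1) - K (c₀ - c₁)) * F x‖ ≤ g (x 0) * h (x 1) := by
    intro x
    rw [F_apply]
    by_cases hgh0 : g (x 0) * h (x 1) = 0
    · rw [hgh0]
      simp
    obtain ⟨hg1, hh1⟩ := mul_ne_zero_iff.1 hgh0
    have hg2 : dist (x 0) c₀ < g.rOut := lt_of_not_ge fun h' => hg1 (g.zero_of_le_dist h')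
    have hh2 : dist (x 1) c₁ < h.rOut := lt_of_not_ge fun h' => hh1 (h.zero_of_le_dist h')
    rw [dist_eq_norm] at hg2 hh2
    have hd : dist (x 0 - x 1) (c₀ - c₁) < ρ := by
      rw [dist_eq_norm]
      calc ‖x 0 - x 1 - (c₀ - c₁)‖ = ‖(x 0 - c₀) - (x 1 - c₁)‖ := by congr 1; abel
        _ ≤ ‖x 0 - c₀‖ + ‖x 1 - c₁‖ := norm_sub_le _ _
        _ < ρ := by linarith
    have hKx := hρK _ hd
    rw [dist_eq_norm] at hKx
    have hprod : 0 ≤ g (x 0) * h (x 1) := mul_nonneg g.nonneg h.nonneg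
    rw [norm_mul, Complex.norm_real, Real.norm_of_nonneg hprod]
    exact mul_le_of_le_one_left hprod hKx.le
  have hdiff : (∫ x : Fin 2 → EuclideanSpace ℝ (Fin 4), K (x 0 - x 1) * F x) -
      K (c₀ - c₁) * (((∫ y, g y) * ∫ y, h y : ℝ) : ℂ) =
      ∫ x : Fin 2 → EuclideanSpace ℝ (Fin 4), (K (x 0 - x 1) - K (c₀ - c₁)) * F x := by
    rw [← hIF, ← integral_const_mul, ← integral_sub hint (hFi.const_mul (K (c₀ - c₁)))]
    congr 1
    funext x
    ring
  rw [hdiff, ← hIgh]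
  exact norm_integral_le_of_norm_le hintgh (Eventually.of_forall hK1)

/-- **Algebra of the two estimates.** From `‖S‖ ≤ A I₀ I₁ + B ε⁸` (the local two-point bound on the bumps),
`‖S − K(ξ) I₀ I₁‖ ≤ I₀ I₁` (bump localisation), `B ≥ 0` and `I₀, I₁ ≥ (ε/2)⁴ v₁` (inner balls):
`‖K(ξ)‖ ≤ 1 + A + B 2⁸ / v₁²`. [folklore] -/
theorem norm_le_of_local_estimates {Kξ S : ℂ} {I₀ I₁ A B ε v₁ : ℝ} (hv₁ : 0 < v₁) (hε : 0 < ε)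
    (hB : 0 ≤ B)
    (hI₀ : (ε / 2) ^ 4 * v₁ ≤ I₀) (hI₁ : (ε / 2) ^ 4 * v₁ ≤ I₁)
    (hZ : ‖S‖ ≤ A * I₀ * I₁ + B * ε ^ 8)
    (h2 : ‖S - Kξ * ((I₀ * I₁ : ℝ) : ℂ)‖ ≤ I₀ * I₁) :
    ‖Kξ‖ ≤ 1 + A + B * 2 ^ 8 / v₁ ^ 2 := by
  have hQ0 : 0 ≤ B * 2 ^ 8 / v₁ ^ 2 := by positivity
  have hlow : 0 < (ε / 2) ^ 4 * v₁ := by positivity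
  have hI₀pos : 0 < I₀ := hlow.trans_le hI₀
  have hP : 0 < I₀ * I₁ := mul_pos hI₀pos (hlow.trans_le hI₁)
  have hBst : B * ε ^ 8 ≤ B * 2 ^ 8 / v₁ ^ 2 * (I₀ * I₁) := by
    have hQ : B * ε ^ 8 = B * 2 ^ 8 / v₁ ^ 2 * ((ε / 2) ^ 4 * v₁ * ((ε / 2) ^ 4 * v₁)) := by
      field_simp
    rw [hQ]
    exact mul_le_mul_of_nonneg_left (mul_le_mul hI₀ hI₁ hlow.le hI₀pos.le) hQ0
  have e1 : ‖Kξ‖ * (I₀ * I₁) = ‖Kξ * ((I₀ * I₁ : ℝ) : ℂ)‖ := by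
    rw [norm_mul, Complex.norm_real, Real.norm_of_nonneg hP.le]
  have tri : ‖Kξ * ((I₀ * I₁ : ℝ) : ℂ)‖ ≤ ‖S‖ + ‖S - Kξ * ((I₀ * I₁ : ℝ) : ℂ)‖ := by
    calc ‖Kξ * ((I₀ * I₁ : ℝ) : ℂ)‖ = ‖S - (S - Kξ * ((I₀ * I₁ : ℝ) : ℂ))‖ := by congr 1; ring
      _ ≤ ‖S‖ + ‖S - Kξ * ((I₀ * I₁ : ℝ) : ℂ)‖ := norm_sub_le _ _
  have hkey : ‖Kξ‖ * (I₀ * I₁) ≤ (1 + A + B * 2 ^ 8 / v₁ ^ 2) * (I₀ * I₁) := by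
    rw [e1]
    linarith [tri, h2, hZ, hBst]
  exact le_of_mul_le_mul_right hkey hP

/-- **From the local constants to the scale.** If `0 ≤ A`, `0 ≤ B`, `A + B ≤ C (s/2)^(η−10)` with `0 < s`,
then `A + B 2⁸ / v₁² ≤ (1 + 2⁸/v₁²) · max C 0 · (1/2)^(η−10) · s^(η−10)`. [folklore] -/
theorem local_consts_le_scale {A B C s η v₁ : ℝ} (hs : 0 < s) (hA : 0 ≤ A) (hB : 0 ≤ B)
    (hAB : A + B ≤ C * (s / 2) ^ (η - 10)) :
    A + B * 2 ^ 8 / v₁ ^ 2 ≤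
      ((1 + 2 ^ 8 / v₁ ^ 2) * max C 0 * (1 / 2 : ℝ) ^ (η - 10)) * s ^ (η - 10) := by
  have hc : (0 : ℝ) ≤ 2 ^ 8 / v₁ ^ 2 := by positivity
  have hpos : 0 ≤ (s / 2) ^ (η - 10) := Real.rpow_nonneg (half_pos hs).le _
  have hAB' : A + B ≤ max C 0 * (s / 2) ^ (η - 10) :=
    hAB.trans (mul_le_mul_of_nonneg_right (le_max_left _ _) hpos)
  have hpow : (s / 2) ^ (η - 10) = (1 / 2 : ℝ) ^ (η - 10) * s ^ (η - 10) := by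
    rw [← Real.mul_rpow (x := 1 / 2) (y := s) (by norm_num) hs.le]
    congr 1
    ring
  have h1 : A + B * 2 ^ 8 / v₁ ^ 2 ≤ (1 + 2 ^ 8 / v₁ ^ 2) * (A + B) := by
    have e : (1 + 2 ^ 8 / v₁ ^ 2) * (A + B) = A + B * 2 ^ 8 / v₁ ^ 2 + (B + 2 ^ 8 / v₁ ^ 2 * A) := by
      ring
    rw [e]
    linarith [mul_nonneg hc hA]
  have h2 : (1 + 2 ^ 8 / v₁ ^ 2) * (A + B) ≤ (1 + 2 ^ 8 / v₁ ^ 2) * (max C 0 * (s / 2) ^ (η - 10)) :=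
    mul_le_mul_of_nonneg_left hAB' (by linarith)
  calc A + B * 2 ^ 8 / v₁ ^ 2 ≤ (1 + 2 ^ 8 / v₁ ^ 2) * (max C 0 * (s / 2) ^ (η - 10)) := h1.trans h2
    _ = ((1 + 2 ^ 8 / v₁ ^ 2) * max C 0 * (1 / 2 : ℝ) ^ (η - 10)) * s ^ (η - 10) := by
        rw [hpow]; ring

/-- Two closed `ε`-balls about `∓(s/2) e₀` in `ℝ⁴` are disjoint once `ε ≤ s/8` (`0 < s`): the centres are at
distance `s > 2ε`. [folklore] -/
theorem disjoint_closedBall_halfAxis {s ε : ℝ} (hs : 0 < s) (hε : ε ≤ s / 8) :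
    Disjoint (Metric.closedBall (EuclideanSpace.single (0 : Fin 4) (-(s / 2)) : EuclideanSpace ℝ (Fin 4)) ε)
      (Metric.closedBall (EuclideanSpace.single (0 : Fin 4) (s / 2) : EuclideanSpace ℝ (Fin 4)) ε) := by
  refine Metric.closedBall_disjoint_closedBall ?_
  have hdist : dist (EuclideanSpace.single (0 : Fin 4) (-(s / 2)) : EuclideanSpace ℝ (Fin 4))
      (EuclideanSpace.single (0 : Fin 4) (s / 2)) = s := by
    rw [PiLp.dist_single_same, Real.dist_eq, show -(s / 2) - s / 2 = -s by ring, abs_neg, abs_of_pos hs]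
  rw [hdist]
  linarith

/-- The difference of the two centres is `−s e₀`: `(−(s/2)) e₀ − (s/2) e₀ = (−s) e₀`. [folklore] -/
theorem single_half_sub_single_half (s : ℝ) :
    (EuclideanSpace.single (0 : Fin 4) (-(s / 2)) : EuclideanSpace ℝ (Fin 4)) - EuclideanSpace.single (0 : Fin 4) (s / 2) =
      EuclideanSpace.single (0 : Fin 4) (-s) := by
  rw [show -s = -(s / 2) - s / 2 by ring]
  exact (PiLp.single_sub 2 (0 : Fin 4)).symm

/-- `−(s e₀) = (−s) e₀`. [folklore] -/
theorem neg_single_axis (s : ℝ) :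
    -(EuclideanSpace.single (0 : Fin 4) s : EuclideanSpace ℝ (Fin 4)) = EuclideanSpace.single (0 : Fin 4) (-s) :=
  (PiLp.single_neg 2 (0 : Fin 4)).symm

end AxialGrowthOfLocalDecayAux

open LatticeWindow BoundedRenormalisation AxialGrowthOfLocalDecayAux in
/-- **`AxialGrowthOfLocalDecay`** (Stub I₂ of line `sixteen-charts-analytic-kernel`, crux `PencilRigidity.CurvatureKernelBound`,
registered signature verbatim). T `TwoPointLocalDecay` ⇒ for every `W₁`-datum every kernel `K` continuous off `0`
representing `S₁ 2` on `⁰𝒮₂` obeys `‖K(s e₀)‖ ≤ C' s^(min η 10 − 10)` on `(0,1]`: T at height `s/2` on the real tensor of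
two standard bumps at `∓(s/2) e₀`, bump localisation, `∫ bump ≥ (ε/2)⁴ v₁`, evenness of the kernel (`kernel_neg`) and
continuity on the compact axial segment `[min 1 s₁, 1]`. See the module docstring. [folklore] -/
theorem AxialGrowthOfLocalDecay : open Literature.MathematicalPhysics.QuantumLattice Literature.MathematicalPhysics.AQFT Literature.MathematicalPhysics.QuantumFieldTheory in (∀ (G : Type) [Group G] [TopologicalSpace G] [IsTopologicalGroup G] [CompactSpace G] [MeasurableSpace G] [BorelSpace G], IsCompactSimpleLieGroup G → ∀ (r : LatticeRep G) (sch : SpeciesScheme (YMSpecies G)) (S₁ : SchwingerFamily (EuclideanSpace ℝ (Fin 4))), ((∀ (n : ℕ), n ≠ 0 → ∀ (f : Fin n → SchwartzMap (EuclideanSpace ℝ (Fin 4)) ℝ) (F : SchwartzMap (Fin n → (EuclideanSpace ℝ (Fin 4))) ℂ), IsTensorOf F (fun i => ofRealTest (f i)) → IsOffDiagonal F → Filter.Tendsto (fun k : ℕ => ((latticeSchwinger r.ρ sch (fun s => s.F) k n (fun _ => r.curvature) f : ℝ) : ℂ)) Filter.atTop (nhds (S₁ n F))) ∧ (S₁.toLabelled.IsNormalized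 ∧ S₁.toLabelled.IsHermitian ∧ S₁.toLabelled.HasLinearGrowth ∧ S₁.toLabelled.IsReflectionPositive ∧ S₁.toLabelled.IsSymmetric ∧ S₁.toLabelled.HasClusterProperty) ∧ (∀ (n : ℕ) (a : (EuclideanSpace ℝ (Fin 4))) (F : SchwartzMap (Fin n → (EuclideanSpace ℝ (Fin 4))) ℂ), IsOffDiagonal F → S₁ n (translateMulti a F) = S₁ n F) ∧ (∀ (R : (EuclideanSpace ℝ (Fin 4)) ≃ₗᵢ[ℝ] (EuclideanSpace ℝ (Fin 4))), LinearMap.det (R.toLinearEquiv : (EuclideanSpace ℝ (Fin 4)) →ₗ[ℝ] (EuclideanSpace ℝ (Fin 4))) = 1 → (∀ i : Fin 4, ∃ j : Fin 4, R (EuclideanSpace.single i 1) = EuclideanSpace.single j 1 ∨ R (EuclideanSpace.single i 1) = -EuclideanSpace.single j 1) → ∀ (n : ℕ) (F : SchwartzMap (Fin n → (EuclideanSpace ℝ (Fin 4))) ℂ), IsOffDiagonal F → S₁ n (linActMulti R F) = S₁ n F) ∧ (∃ Δ : ℝ, 0 < Δ ∧ S₁.toLabelled.HasMassGap Δ ∧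 HasLatticeMassGap r sch Δ)) → ∃ (C η s₁ : ℝ), 0 < η ∧ 0 < s₁ ∧ (∀ (s : ℝ), 0 < s → s < s₁ → ∃ (r₀ A B : ℝ), 0 < r₀ ∧ 0 ≤ A ∧ 0 ≤ B ∧ A + B ≤ C * s ^ (η - 10) ∧ (∀ (r : ℝ), 0 < r → r ≤ r₀ → ∀ (f : Fin 2 → SchwartzMap (EuclideanSpace ℝ (Fin 4)) ℝ) (F : SchwartzMap (Fin 2 → (EuclideanSpace ℝ (Fin 4))) ℂ) (M₀ M₁ : ℝ), IsTensorOf F (fun i => ofRealTest (f i)) → tsupport ((f 0 : SchwartzMap (EuclideanSpace ℝ (Fin 4)) ℝ) : (EuclideanSpace ℝ (Fin 4)) → ℝ) ⊆ Metric.closedBall (EuclideanSpace.single (0 : Fin 4) (-s)) r → tsupport ((f 1 : SchwartzMap (EuclideanSpace ℝ (Fin 4)) ℝ) : (EuclideanSpace ℝ (Fin 4)) → ℝ) ⊆ Metric.closedBall (EuclideanSpace.single (0 : Fin 4) s) r → (∀ x, |f 0 x| ≤ M₀) → (∀ x, |f 1 x| ≤ M₁) → ‖S₁ 2 F‖ ≤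 A * (∫ x : (EuclideanSpace ℝ (Fin 4)), |f 0 x|) * (∫ x : (EuclideanSpace ℝ (Fin 4)), |f 1 x|) + B * r ^ 8 * M₀ * M₁))) → ∀ (G : Type) [Group G] [TopologicalSpace G] [IsTopologicalGroup G] [CompactSpace G] [MeasurableSpace G] [BorelSpace G], IsCompactSimpleLieGroup G → ∀ (r : LatticeRep G) (sch : SpeciesScheme (YMSpecies G)) (S₁ : SchwingerFamily (EuclideanSpace ℝ (Fin 4))), ((∀ (n : ℕ), n ≠ 0 → ∀ (f : Fin n → SchwartzMap (EuclideanSpace ℝ (Fin 4)) ℝ) (F : SchwartzMap (Fin n → (EuclideanSpace ℝ (Fin 4))) ℂ), IsTensorOf F (fun i => ofRealTest (f i)) → IsOffDiagonal F → Filter.Tendsto (fun k : ℕ => ((latticeSchwinger r.ρ sch (fun s => s.F) k n (fun _ => r.curvature) f : ℝ) : ℂ)) Filter.atTop (nhds (S₁ n F))) ∧ (S₁.toLabelled.IsNormalized ∧ S₁.toLabelled.IsHermitian ∧ S₁.toLabelled.HasLinearGrowth ∧ S₁.toLabelled.IsReflectionPositive ∧ S₁.toLabelled.IsSymmetric ∧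 S₁.toLabelled.HasClusterProperty) ∧ (∀ (n : ℕ) (a : (EuclideanSpace ℝ (Fin 4))) (F : SchwartzMap (Fin n → (EuclideanSpace ℝ (Fin 4))) ℂ), IsOffDiagonal F → S₁ n (translateMulti a F) = S₁ n F) ∧ (∀ (R : (EuclideanSpace ℝ (Fin 4)) ≃ₗᵢ[ℝ] (EuclideanSpace ℝ (Fin 4))), LinearMap.det (R.toLinearEquiv : (EuclideanSpace ℝ (Fin 4)) →ₗ[ℝ] (EuclideanSpace ℝ (Fin 4))) = 1 → (∀ i : Fin 4, ∃ j : Fin 4, R (EuclideanSpace.single i 1) = EuclideanSpace.single j 1 ∨ R (EuclideanSpace.single i 1) = -EuclideanSpace.single j 1) → ∀ (n : ℕ) (F : SchwartzMap (Fin n → (EuclideanSpace ℝ (Fin 4))) ℂ), IsOffDiagonal F → S₁ n (linActMulti R F) = S₁ n F) ∧ (∃ Δ : ℝ, 0 < Δ ∧ S₁.toLabelled.HasMassGap Δ ∧ HasLatticeMassGap r sch Δ)) → ∀ (K : (EuclideanSpace ℝ (Fin 4)) → ℂ), ContinuousOn K {x : (EuclideanSpace ℝ (Fin 4)) | x ≠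 0} → (∀ F : SchwartzMap (Fin 2 → (EuclideanSpace ℝ (Fin 4))) ℂ, IsOffDiagonal F → MeasureTheory.Integrable (fun x : Fin 2 → (EuclideanSpace ℝ (Fin 4)) => K (x 0 - x 1) * F x) ∧ S₁ 2 F = ∫ x : Fin 2 → (EuclideanSpace ℝ (Fin 4)), K (x 0 - x 1) * F x) → ∃ C η : ℝ, 0 < η ∧ ∀ s : ℝ, 0 < s → s ≤ 1 → ‖K (EuclideanSpace.single 0 s)‖ ≤ C * s ^ (η - 10) := by
  intro hT G _ _ _ _ _ _ hG r sch S₁ hW₁ K hcont hrep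
  obtain ⟨C, η, s₁, hη, hs₁, hdec⟩ := hT G hG r sch S₁ hW₁
  -- evenness of the representing kernel (proper signed permutations: `R = -1`)
  have heven : ∀ x : EuclideanSpace ℝ (Fin 4), x ≠ 0 → K (-x) = K x :=
    kernel_neg S₁ K hcont hrep hW₁.2.2.2.1
  -- Lebesgue measure on `(ℝ⁴)²` has temperate growth (Schwartz functions are integrable)
  haveI : (volume : Measure (Fin 2 → EuclideanSpace ℝ (Fin 4))).HasTemperateGrowth :=
    Measure.IsAddHaarMeasure.instHasTemperateGrowth
  -- the volume of the unit ball
  obtain ⟨v₁, hv₁def⟩ : ∃ v : ℝ, (volume : Measure (EuclideanSpace ℝ (Fin 4))).real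
      (Metric.closedBall (0 : EuclideanSpace ℝ (Fin 4)) 1) = v := ⟨_, rfl⟩
  have hv₁ : 0 < v₁ := by
    rw [← hv₁def]
    exact ENNReal.toReal_pos (Metric.measure_closedBall_pos volume _ one_pos).ne'
      measure_closedBall_lt_top.ne
  -- constants
  have hQnn : (0 : ℝ) ≤ (1 + 2 ^ 8 / v₁ ^ 2) * max C 0 * (1 / 2 : ℝ) ^ (η - 10) :=
    mul_nonneg (mul_nonneg (by positivity) (le_max_right _ _)) (Real.rpow_nonneg (by norm_num) _)
  set Q : ℝ := (1 + 2 ^ 8 / v₁ ^ 2) * max C 0 * (1 / 2 : ℝ) ^ (η - 10) with hQ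
  set s₀ : ℝ := min 1 s₁
  have hs₀pos : 0 < s₀ := lt_min one_pos hs₁
  -- ### the bound near the origin: `0 < s ≤ s₀`
  have hsmall : ∀ s : ℝ, 0 < s → s ≤ s₀ →
      ‖K (EuclideanSpace.single 0 s)‖ ≤ 1 + Q * s ^ (η - 10) := by
    intro s hs hss₀
    have hs2 : s / 2 < s₁ := by
      have : s ≤ s₁ := hss₀.trans (min_le_right _ _)
      linarith
    -- T at height `s/2`
    obtain ⟨r₀, A, B, hr₀, hA, hB, hAB, hLB⟩ := hdec (s / 2) (half_pos hs) hs2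
    -- the point `ξ = -s e₀` as the difference of the two centres
    have hξs : (EuclideanSpace.single (0 : Fin 4) (-(s / 2)) : EuclideanSpace ℝ (Fin 4)) -
        EuclideanSpace.single (0 : Fin 4) (s / 2) = EuclideanSpace.single (0 : Fin 4) (-s) :=
      single_half_sub_single_half s
    have hξ : (EuclideanSpace.single (0 : Fin 4) (-(s / 2)) : EuclideanSpace ℝ (Fin 4)) -
        EuclideanSpace.single (0 : Fin 4) (s / 2) ≠ 0 := by
      rw [hξs]
      intro h0
      have : -s = 0 := (PiLp.single_eq_zero_iff 2 _).1 h0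
      linarith
    -- a continuity radius of `K` at `ξ`
    have hKat : ContinuousAt K ((EuclideanSpace.single (0 : Fin 4) (-(s / 2)) : EuclideanSpace ℝ (Fin 4)) -
        EuclideanSpace.single (0 : Fin 4) (s / 2)) :=
      (hcont _ hξ).continuousAt (isOpen_compl_singleton.mem_nhds hξ)
    obtain ⟨ρ, hρ, hρK⟩ := Metric.continuousAt_iff.1 hKat 1 one_pos
    have hρK' : ∀ z : EuclideanSpace ℝ (Fin 4),
        dist z ((EuclideanSpace.single (0 : Fin 4) (-(s / 2)) : EuclideanSpace ℝ (Fin 4)) -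
          EuclideanSpace.single (0 : Fin 4) (s / 2)) < ρ →
        dist (K z) (K ((EuclideanSpace.single (0 : Fin 4) (-(s / 2)) : EuclideanSpace ℝ (Fin 4)) -
          EuclideanSpace.single (0 : Fin 4) (s / 2))) < 1 :=
      fun z hz => hρK hz
    -- the radius `ε ≤ min (ρ/4) r₀ (s/8)` and the bumps of radii `(ε/2, ε)` at `∓(s/2) e₀`
    obtain ⟨ε, hε, hερ, hεr₀, hεs⟩ : ∃ ε : ℝ, 0 < ε ∧ ε ≤ ρ / 4 ∧ ε ≤ r₀ ∧ ε ≤ s / 8 :=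
      ⟨min (ρ / 4) (min r₀ (s / 8)), lt_min (by linarith) (lt_min hr₀ (by linarith)),
        min_le_left _ _, (min_le_right _ _).trans (min_le_left _ _),
        (min_le_right _ _).trans (min_le_right _ _)⟩
    let g : ContDiffBump (EuclideanSpace.single (0 : Fin 4) (-(s / 2)) : EuclideanSpace ℝ (Fin 4)) :=
      ⟨ε / 2, ε, by linarith, by linarith⟩
    let h : ContDiffBump (EuclideanSpace.single (0 : Fin 4) (s / 2) : EuclideanSpace ℝ (Fin 4)) :=
      ⟨ε / 2, ε, by linarith, by linarith⟩
    let gS : 𝓢(EuclideanSpace ℝ (Fin 4), ℝ) := g.hasCompactSupport.toSchwartzMap g.contDiff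
    let hS : 𝓢(EuclideanSpace ℝ (Fin 4), ℝ) := h.hasCompactSupport.toSchwartzMap h.contDiff
    have gS_apply : ∀ x, gS x = g x := fun _ => rfl
    have hS_apply : ∀ x, hS x = h x := fun _ => rfl
    let F : 𝓢((Fin 2 → EuclideanSpace ℝ (Fin 4)), ℂ) := SchwartzMap.tensorFin 2 ![ofRealTest gS, ofRealTest hS]
    have F_apply : ∀ x : Fin 2 → EuclideanSpace ℝ (Fin 4), F x = ((g (x 0) * h (x 1) : ℝ) : ℂ) := by
      intro x
      rw [tensorFin_two_apply, ofRealTest_apply, ofRealTest_apply, gS_apply, hS_apply]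
      push_cast
      rfl
    have hFt : IsTensorOf F (fun i => ofRealTest (![gS, hS] i)) := isTensorOf_tensorFin_two_ofRealTest gS hS
    -- supports: closed `ε`-balls about the two centres, disjoint
    have hsuppg : tsupport (gS : EuclideanSpace ℝ (Fin 4) → ℝ) ⊆
        Metric.closedBall (EuclideanSpace.single (0 : Fin 4) (-(s / 2))) ε := by
      have hs' : Function.support (gS : EuclideanSpace ℝ (Fin 4) → ℝ) =
          Function.support (g : EuclideanSpace ℝ (Fin 4) → ℝ) := by
        ext y; rw [Function.mem_support, Function.mem_support, gS_apply]
      have ht : tsupport (g : EuclideanSpace ℝ (Fin 4) → ℝ) = Metric.closedBall _ g.rOut := g.tsupport_eq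
      change closure (Function.support _) ⊆ _
      rw [hs']
      exact ht.subset
    have hsupph : tsupport (hS : EuclideanSpace ℝ (Fin 4) → ℝ) ⊆
        Metric.closedBall (EuclideanSpace.single (0 : Fin 4) (s / 2)) ε := by
      have hs' : Function.support (hS : EuclideanSpace ℝ (Fin 4) → ℝ) =
          Function.support (h : EuclideanSpace ℝ (Fin 4) → ℝ) := by
        ext y; rw [Function.mem_support, Function.mem_support, hS_apply]
      have ht : tsupport (h : EuclideanSpace ℝ (Fin 4) → ℝ) = Metric.closedBall _ h.rOut := h.tsupport_eq
      change closure (Function.support _) ⊆ _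
      rw [hs']
      exact ht.subset
    have hsuppg' : tsupport (ofRealTest gS : EuclideanSpace ℝ (Fin 4) → ℂ) ⊆
        Metric.closedBall (EuclideanSpace.single (0 : Fin 4) (-(s / 2))) ε := by
      have hs' : Function.support (ofRealTest gS : EuclideanSpace ℝ (Fin 4) → ℂ) =
          Function.support (gS : EuclideanSpace ℝ (Fin 4) → ℝ) := by
        ext y; simp [ofRealTest_apply]
      change closure (Function.support _) ⊆ _
      rw [hs']
      exact hsuppg
    have hsupph' : tsupport (ofRealTest hS : EuclideanSpace ℝ (Fin 4) → ℂ) ⊆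
        Metric.closedBall (EuclideanSpace.single (0 : Fin 4) (s / 2)) ε := by
      have hs' : Function.support (ofRealTest hS : EuclideanSpace ℝ (Fin 4) → ℂ) =
          Function.support (hS : EuclideanSpace ℝ (Fin 4) → ℝ) := by
        ext y; simp [ofRealTest_apply]
      change closure (Function.support _) ⊆ _
      rw [hs']
      exact hsupph
    have hdisj := disjoint_closedBall_halfAxis hs hεs
    have hFoff : IsOffDiagonal F := isOffDiagonal_tensorFin_two
      (Set.disjoint_left.2 fun x hxg hxh => Set.disjoint_left.1 hdisj (hsuppg' hxg) (hsupph' hxh))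
    -- T applied to the real tensor `g ⊗ h` (`M₀ = M₁ = 1`, radius `ε ≤ r₀`)
    have hf0 : (![gS, hS] : Fin 2 → 𝓢(EuclideanSpace ℝ (Fin 4), ℝ)) 0 = gS := rfl
    have hf1 : (![gS, hS] : Fin 2 → 𝓢(EuclideanSpace ℝ (Fin 4), ℝ)) 1 = hS := rfl
    have hb0 : ∀ x, |(![gS, hS] : Fin 2 → 𝓢(EuclideanSpace ℝ (Fin 4), ℝ)) 0 x| ≤ 1 := fun x => by
      rw [hf0, gS_apply, abs_of_nonneg g.nonneg]
      exact g.le_one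
    have hb1 : ∀ x, |(![gS, hS] : Fin 2 → 𝓢(EuclideanSpace ℝ (Fin 4), ℝ)) 1 x| ≤ 1 := fun x => by
      rw [hf1, hS_apply, abs_of_nonneg h.nonneg]
      exact h.le_one
    have hZ := hLB ε hε hεr₀ ![gS, hS] F 1 1 hFt (by rw [hf0]; exact hsuppg) (by rw [hf1]; exact hsupph) hb0 hb1
    rw [hf0, hf1, mul_one, mul_one] at hZ
    have habsg : ∀ x, |gS x| = g x := fun x => by rw [gS_apply, abs_of_nonneg g.nonneg]
    have habsh : ∀ x, |hS x| = h x := fun x => by rw [hS_apply, abs_of_nonneg h.nonneg]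
    simp only [habsg, habsh] at hZ
    -- hZ : ‖S₁ 2 F‖ ≤ A * (∫ x, g x) * (∫ x, h x) + B * ε ^ 8
    -- bump localisation of the representing kernel
    obtain ⟨hint, hS2⟩ := hrep F hFoff
    have hsum : g.rOut + h.rOut ≤ ρ := by
      show ε + ε ≤ ρ
      linarith
    have h2 := norm_integral_kernel_two_bumps_sub_le hρK' g h hsum F_apply F.integrable hint
    rw [← hS2] at h2
    -- the integrals of the bumps dominate the volume of the inner balls
    have hI₀ : (ε / 2) ^ 4 * v₁ ≤ ∫ y, g y := by
      have h1 := rIn_pow_mul_le_integral g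
      rwa [hv₁def] at h1
    have hI₁ : (ε / 2) ^ 4 * v₁ ≤ ∫ y, h y := by
      have h1 := rIn_pow_mul_le_integral h
      rwa [hv₁def] at h1
    -- algebra
    have hK1 := norm_le_of_local_estimates hv₁ hε hB hI₀ hI₁ hZ h2
    have hK2 := local_consts_le_scale (η := η) (v₁ := v₁) hs hA hB hAB
    rw [← hQ] at hK2
    -- evenness: `K (s e₀) = K (-s e₀) = K ξ`
    have hxs : (EuclideanSpace.single (0 : Fin 4) s : EuclideanSpace ℝ (Fin 4)) ≠ 0 := fun h0 =>
      hs.ne' ((PiLp.single_eq_zero_iff 2 _).1 h0)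
    have hKs : K (EuclideanSpace.single 0 s) =
        K ((EuclideanSpace.single (0 : Fin 4) (-(s / 2)) : EuclideanSpace ℝ (Fin 4)) -
          EuclideanSpace.single (0 : Fin 4) (s / 2)) := by
      rw [← heven _ hxs, hξs, neg_single_axis]
    rw [hKs]
    linarith
  -- ### the bound on `[s₀, 1]` by continuity, and assembly
  obtain ⟨M, hM0, hM⟩ := exists_bound_on_axial_segment hcont hs₀pos
  set η' : ℝ := min η 10
  have hη'pos : 0 < η' := lt_min hη (by norm_num)
  have hη'le : η' ≤ η := min_le_left _ _
  have hη'10 : η' - 10 ≤ 0 := by linarith [min_le_right η 10]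
  refine ⟨1 + Q + M, η', hη'pos, fun s hs hs1 => ?_⟩
  -- on `(0,1]`: `1 ≤ s^(η'-10)` and `s^(η-10) ≤ s^(η'-10)`
  have hone : 1 ≤ s ^ (η' - 10) := Real.one_le_rpow_of_pos_of_le_one_of_nonpos hs hs1 hη'10
  have hmono : s ^ (η - 10) ≤ s ^ (η' - 10) :=
    Real.rpow_le_rpow_of_exponent_ge hs hs1 (by linarith)
  by_cases hcase : s ≤ s₀
  · have h1 := hsmall s hs hcase
    calc ‖K (EuclideanSpace.single 0 s)‖ ≤ 1 + Q * s ^ (η - 10) := h1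
      _ ≤ 1 * s ^ (η' - 10) + Q * s ^ (η' - 10) + M * s ^ (η' - 10) := by
          nlinarith [mul_le_mul_of_nonneg_left hmono hQnn, mul_nonneg hM0 (zero_le_one.trans hone)]
      _ = (1 + Q + M) * s ^ (η' - 10) := by ring
  · have hs₀s : s₀ ≤ s := (lt_of_not_ge hcase).le
    have h1 := hM s hs₀s hs1
    calc ‖K (EuclideanSpace.single 0 s)‖ ≤ M := h1
      _ = M * 1 := (mul_one M).symm
      _ ≤ M * s ^ (η' - 10) + 1 * s ^ (η' - 10) + Q * s ^ (η' - 10) := by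
          nlinarith [mul_le_mul_of_nonneg_left hone hM0, mul_nonneg hQnn (zero_le_one.trans hone)]
      _ = (1 + Q + M) * s ^ (η' - 10) := by ring

/-- **Sub-goal `AxialGrowthOfLocalDecayLet`**: the stub `AxialGrowthOfLocalDecay` in `let E := ℝ⁴; let X := (ℝ⁴)²` form
(the same proposition up to unfolding the `let`s; registered because the expanded statement of the stub exceeds the
ledger's limit for stub signatures and was stored truncated). [folklore] -/
theorem AxialGrowthOfLocalDecayLet : open Literature.MathematicalPhysics.QuantumLattice Literature.MathematicalPhysics.AQFT Literature.MathematicalPhysics.QuantumFieldTheory in let E := EuclideanSpace ℝ (Fin 4); let X := Fin 2 → E; (∀ (G : Type) [Group G] [TopologicalSpace G] [IsTopologicalGroup G] [CompactSpace G] [MeasurableSpace G] [BorelSpace G], IsCompactSimpleLieGroup G → ∀ (r : LatticeRep G) (sch : SpeciesScheme (YMSpecies G)) (S₁ : SchwingerFamily E), ((∀ (n : ℕ), n ≠ 0 → ∀ (f : Fin n → SchwartzMap E ℝ) (F : SchwartzMap (Fin n → E) ℂ), IsTensorOf F (fun i => ofRealTest (f i)) → IsOffDiagonal F → Filter.Tendsto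 (fun k : ℕ => ((latticeSchwinger r.ρ sch (fun s => s.F) k n (fun _ => r.curvature) f : ℝ) : ℂ)) Filter.atTop (nhds (S₁ n F))) ∧ (S₁.toLabelled.IsNormalized ∧ S₁.toLabelled.IsHermitian ∧ S₁.toLabelled.HasLinearGrowth ∧ S₁.toLabelled.IsReflectionPositive ∧ S₁.toLabelled.IsSymmetric ∧ S₁.toLabelled.HasClusterProperty) ∧ (∀ (n : ℕ) (a : E) (F : SchwartzMap (Fin n → E) ℂ), IsOffDiagonal F → S₁ n (translateMulti a F) = S₁ n F) ∧ (∀ (R : E ≃ₗᵢ[ℝ] E), LinearMap.det (R.toLinearEquiv : E →ₗ[ℝ] E) = 1 → (∀ i : Fin 4, ∃ j : Fin 4, R (EuclideanSpace.single i 1) = EuclideanSpace.single j 1 ∨ R (EuclideanSpace.single i 1) = -EuclideanSpace.single j 1) → ∀ (n : ℕ) (F : SchwartzMap (Fin n → E) ℂ), IsOffDiagonal F → S₁ n (linActMulti R F) = S₁ n F) ∧ (∃ Δ : ℝ, 0 < Δ ∧ S₁.toLabelled.HasMassGap Δ ∧ HasLatticeMassGap r sch Δ)) → ∃ (C η s₁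 : ℝ), 0 < η ∧ 0 < s₁ ∧ (∀ (s : ℝ), 0 < s → s < s₁ → ∃ (r₀ A B : ℝ), 0 < r₀ ∧ 0 ≤ A ∧ 0 ≤ B ∧ A + B ≤ C * s ^ (η - 10) ∧ (∀ (r : ℝ), 0 < r → r ≤ r₀ → ∀ (f : Fin 2 → SchwartzMap E ℝ) (F : SchwartzMap X ℂ) (M₀ M₁ : ℝ), IsTensorOf F (fun i => ofRealTest (f i)) → tsupport ((f 0 : SchwartzMap E ℝ) : E → ℝ) ⊆ Metric.closedBall (EuclideanSpace.single (0 : Fin 4) (-s)) r → tsupport ((f 1 : SchwartzMap E ℝ) : E → ℝ) ⊆ Metric.closedBall (EuclideanSpace.single (0 : Fin 4) s) r → (∀ x, |f 0 x| ≤ M₀) → (∀ x, |f 1 x| ≤ M₁) → ‖S₁ 2 F‖ ≤ A * (∫ x : E, |f 0 x|) * (∫ x : E, |f 1 x|) + B * r ^ 8 * M₀ * M₁))) → ∀ (G : Type) [Group G] [TopologicalSpace G] [IsTopologicalGroup G] [CompactSpace G] [MeasurableSpace G] [BorelSpace G], IsCompactSimpleLieGroup G → ∀ (r : LatticeRep G)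 (sch : SpeciesScheme (YMSpecies G)) (S₁ : SchwingerFamily E), ((∀ (n : ℕ), n ≠ 0 → ∀ (f : Fin n → SchwartzMap E ℝ) (F : SchwartzMap (Fin n → E) ℂ), IsTensorOf F (fun i => ofRealTest (f i)) → IsOffDiagonal F → Filter.Tendsto (fun k : ℕ => ((latticeSchwinger r.ρ sch (fun s => s.F) k n (fun _ => r.curvature) f : ℝ) : ℂ)) Filter.atTop (nhds (S₁ n F))) ∧ (S₁.toLabelled.IsNormalized ∧ S₁.toLabelled.IsHermitian ∧ S₁.toLabelled.HasLinearGrowth ∧ S₁.toLabelled.IsReflectionPositive ∧ S₁.toLabelled.IsSymmetric ∧ S₁.toLabelled.HasClusterProperty) ∧ (∀ (n : ℕ) (a : E) (F : SchwartzMap (Fin n → E) ℂ), IsOffDiagonal F → S₁ n (translateMulti a F) = S₁ n F) ∧ (∀ (R : E ≃ₗᵢ[ℝ] E), LinearMap.det (R.toLinearEquiv : E →ₗ[ℝ] E) = 1 → (∀ i : Fin 4, ∃ j : Fin 4, R (EuclideanSpace.single i 1) = EuclideanSpace.single j 1 ∨ R (EuclideanSpace.single i 1) = -EuclideanSpace.single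 j 1) → ∀ (n : ℕ) (F : SchwartzMap (Fin n → E) ℂ), IsOffDiagonal F → S₁ n (linActMulti R F) = S₁ n F) ∧ (∃ Δ : ℝ, 0 < Δ ∧ S₁.toLabelled.HasMassGap Δ ∧ HasLatticeMassGap r sch Δ)) → ∀ (K : E → ℂ), ContinuousOn K {x : E | x ≠ 0} → (∀ F : SchwartzMap X ℂ, IsOffDiagonal F → MeasureTheory.Integrable (fun x : X => K (x 0 - x 1) * F x) ∧ S₁ 2 F = ∫ x : X, K (x 0 - x 1) * F x) → ∃ C η : ℝ, 0 < η ∧ ∀ s : ℝ, 0 < s → s ≤ 1 → ‖K (EuclideanSpace.single 0 s)‖ ≤ C * s ^ (η - 10) := by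
  intro E X
  exact AxialGrowthOfLocalDecay

end Summit.QuantumFields.YangMills.Theorems.CurvatureKernel

end
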